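import Mathlib.RingTheory.RegularLocalRing.Defs
import Mathlib.RingTheory.Localization.LocalizationLocalization
import Mathlib.RingTheory.Localization.AtPrime.Basic
import Mathlib.RingTheory.Localization.Away.Basic
import Mathlib.RingTheory.AdjoinRoot
import Mathlib.FieldTheory.Minpoly.Field
import HarnessLib

/-!
# Three lemmas for Stacks 07PI (complete local domains are J-0)

Topic: `Literature/AlgebraicGeometry/Resolution`. Generic commutative algebra used in
`CompleteLocalDomainJ0.lean` (Stacks 07PI), kept apart because it needs only Mathlib:

* `isRegularRing_of_isLocalization_away` — if `C_Q` is regular for every prime `Q ∌ g` then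
  `C[1/g]` is a regular ring (a J-0 witness gives a regular ring of fractions);
* `isRegularLocalRing_of_dominated` — a local ring `W` receiving a ring homomorphism `ψ` from a
  regular ring `T`, compatibly with embeddings of `T` and `W` into a common field and with every
  element of `W` a fraction `ψ(t)/ψ(u)`, is the localisation of `T` at `ψ⁻¹(𝔪_W)`, hence regular;
* `AdjoinRoot.lift_injective_of_minpoly_eq_map` — `S[X]/(q) → K`, `X ↦ x`, is injective when the
  image of the monic `q` in `F[X]` (`S ↪ F ⊆ K` fields) is the minimal polynomial of `x` over `F`.

Everything is proved; no named facts. [folklore]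
-/

noncomputable section

open IsLocalRing Polynomial

namespace Literature.AlgebraicGeometry.Resolution

universe u

/-! ## From a J-0 witness to a regular ring of fractions -/

/-- If every local ring `C_Q` with `g ∉ Q` is regular, then `C[1/g]` is a regular ring (its local
rings are exactly these `C_Q`). [folklore] -/
theorem isRegularRing_of_isLocalization_away {C : Type u} [CommRing C] [IsNoetherianRing C]
    {g : C} (hg : ∀ (Q : Ideal C) [Q.IsPrime], g ∉ Q → IsRegularLocalRing (Localization.AtPrime Q))
    (L : Type u) [CommRing L] [Algebra C L] [IsLocalization.Away g L] : IsRegularRing L := by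
  haveI : IsNoetherianRing L := IsLocalization.isNoetherianRing (Submonoid.powers g) L ‹_›
  refine isRegularRing_iff.mpr fun P hP => ?_
  set Q := P.comap (algebraMap C L) with hQ
  have hgQ : g ∉ Q := fun h => hP.ne_top (P.eq_top_of_isUnit_mem h
    (IsLocalization.Away.algebraMap_isUnit (S := L) g))
  haveI : IsLocalization.AtPrime (Localization.AtPrime P) Q :=
    IsLocalization.isLocalization_isLocalization_atPrime_isLocalization (Submonoid.powers g)
      (Localization.AtPrime P) P
  haveI := hg Q hgQ
  exact IsRegularLocalRing.of_ringEquiv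
    (IsLocalization.algEquiv Q.primeCompl (Localization.AtPrime Q) (Localization.AtPrime P)).toRingEquiv

/-! ## A local ring dominated by a regular ring inside a field -/

/-- **Localisation detected inside a field.** Let `ψ : T → W` be a ring homomorphism into a local
ring, and suppose `T` and `W` embed compatibly into a field (`ι ∘ ψ = φ` with `φ`, `ι`
injective) and every `w ∈ W` is a fraction `ψ(t)/ψ(u)` with `ψ(u)` a unit. Then `W` is the
localisation of `T` at the prime `ψ⁻¹(𝔪_W)`; in particular `W` is a regular local ring if `T` is a
regular ring. [folklore] -/
theorem isRegularLocalRing_of_dominated {T W K : Type u} [CommRing T] [CommRing W] [Field K]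
    [IsLocalRing W] [IsRegularRing T] (ψ : T →+* W) (φ : T →+* K) (ι : W →+* K)
    (hφ : Function.Injective φ) (hcomp : ι.comp ψ = φ)
    (hsurj : ∀ w : W, ∃ t u : T, ψ u ∉ maximalIdeal W ∧ w * ψ u = ψ t) :
    IsRegularLocalRing W := by
  letI : Algebra T W := ψ.toAlgebra
  set 𝔓 : Ideal T := (maximalIdeal W).comap ψ with h𝔓
  haveI h𝔓p : 𝔓.IsPrime := Ideal.comap_isPrime ψ _
  haveI : IsLocalization.AtPrime W 𝔓 := by
    refine ⟨?_, ?_, ?_⟩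
    · rintro ⟨u, hu⟩
      have hu' : ψ u ∉ maximalIdeal W := hu
      exact not_not.mp ((IsLocalRing.mem_maximalIdeal _).not.mp hu')
    · intro w
      obtain ⟨t, u, hu, h⟩ := hsurj w
      exact ⟨⟨t, ⟨u, hu⟩⟩, h⟩
    · intro t₁ t₂ h
      refine ⟨1, ?_⟩
      have : φ t₁ = φ t₂ := by
        rw [← hcomp]
        exact congrArg ι h
      rw [hφ this]
  exact IsRegularLocalRing.of_ringEquiv
    (IsLocalization.algEquiv 𝔓.primeCompl (Localization.AtPrime 𝔓) W).toRingEquiv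

/-! ## Injectivity of `S[X]/(q) → K` when `q` stays the minimal polynomial over a subfield -/

/-- Let `S → F → K` with `S → F` injective, `F` and `K` fields, `x ∈ K`, and `q ∈ S[X]` monic whose
image in `F[X]` is the minimal polynomial of `x` over `F`. Then `S[X]/(q) → K`, `X ↦ x`, is
injective (a class is represented by `r` with `deg r < deg q`, and `r(x) = 0` forces `r = 0` by
minimality). [folklore] -/
theorem AdjoinRoot.lift_injective_of_minpoly_eq_map {S F K : Type u} [CommRing S] [Field F]
    [Field K] [Algebra S F] [Algebra F K] [Algebra S K] [IsScalarTower S F K]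
    (hinj : Function.Injective (algebraMap S F)) (x : K) (q : S[X]) (hq : q.Monic)
    (hmin : minpoly F x = q.map (algebraMap S F)) (hx : q.eval₂ (algebraMap S K) x = 0) :
    Function.Injective (AdjoinRoot.lift (algebraMap S K) x hx) := by
  haveI : Nontrivial S := (algebraMap S F).domain_nontrivial
  rw [injective_iff_map_eq_zero]
  intro z hz
  obtain ⟨f, rfl⟩ := AdjoinRoot.mk_surjective z
  -- reduce `f` modulo the monic `q`
  have hmk : AdjoinRoot.mk q f = AdjoinRoot.mk q (f %ₘ q) := by
    rw [AdjoinRoot.mk_eq_mk, Polynomial.modByMonic_eq_sub_mul_div f q]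
    exact ⟨f /ₘ q, by ring⟩
  rw [hmk] at hz ⊢
  set r := f %ₘ q with hr
  have hdeg : r.degree < q.degree := Polynomial.degree_modByMonic_lt f hq
  -- `r(x) = 0` in `K`
  rw [AdjoinRoot.lift_mk] at hz
  have haeval : Polynomial.aeval x (r.map (algebraMap S F)) = 0 := by
    rw [Polynomial.aeval_map_algebraMap, Polynomial.aeval_def]
    exact hz
  -- minimality of the minimal polynomial
  have hr0 : r.map (algebraMap S F) = 0 := by
    by_contra hne
    have h1 := minpoly.degree_le_of_ne_zero F x hne haeval
    rw [hmin, Polynomial.degree_map_eq_of_injective hinj,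
      Polynomial.degree_map_eq_of_injective hinj] at h1
    exact (not_le.mpr hdeg) h1
  have : r = 0 := Polynomial.map_injective _ hinj (by rw [hr0, Polynomial.map_zero])
  rw [this, map_zero]

end Literature.AlgebraicGeometry.Resolution
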